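import Literature.NumberTheory.Automorphic.RankinSelbergContinuationGlue
import HarnessLib

/-!
# The splitting `L(s, Π) = (∏_{v ∈ S} P_v(q_v^{-s})⁻¹) · L^S(s, Π)` of a standard `L`-function:
what it takes (companion to `Literature.NumberTheory.Automorphic.AutomorphicLFunction`)

Trunk `AutomorphicAxiomatic` (G19), topic `NumberTheory/Automorphic`; proof file (theorems only:
no definition, no named fact, no instance) on top of `RankinSelbergContinuationGlue`.

The named fact `StandardLFunctionData.L_eq_partialStandardL_mul` of `AutomorphicLFunction` says:
for every standard `L`-function datum `D` of a cuspidal `Π` on `GL_n(𝔸_K)` and `re s > 1`,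
`D.L s = (∏_{v ∈ D.S} P_v(q_v^{-s})⁻¹) · partialStandardL ↑D.S D.α s`, where both `D.L s` (product
over all finite places) and `partialStandardL` (product over `v ∉ D.S`) are *unconditional
products* (`tprod`, junk value `1` where not multipliable). In print this is a tautology — the
partial `L`-function `L_S` is *defined* as the product of the local factors over `v ∉ S`
(Jacquet–Shalika (1981), (5.1), p. 554; the fact records `§1`) — but only because the Euler
product converges for `re s > 1`, which is Thm. (5.3) of the source (p. 555). This file makes the
dependence exact:

* `prod_mul_tprod_compl_of_multipliable` — in any commutative topological monoid, a `tprod`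
  splits off a finite product as soon as the complementary `tprod` is multipliable (the monoid
  form of Mathlib's group-only `Multipliable.prod_mul_tprod_compl`);
* `multipliable_compl_of_isUnit_prod` — conversely, if `f` is multipliable and its finite product
  over `s` is a *unit*, then `f` is multipliable off `s` (partial products over `t ⊆ sᶜ` are
  `u⁻¹ ·` partial products over `s ∪ t`);
* `tprod_eq_prod_mul_tprod_compl_iff` — hence over `ℂ` (any Hausdorff topological field) the
  splitting identity `∏' f = (∏_{s} f) · ∏'_{sᶜ} f` holds **iff** `f` is multipliable off `s`,
  **or** `∏_{s} f = 0`, **or** `∏_{s} f = 1`: outside the two degenerate cases the identity *is*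
  the convergence of the complementary product;
* `StandardLFunctionData.L_eq_prod_mul_partialStandardL_of_multipliable` — the splitting of
  `D.L s` at *any* `s` at which the partial Euler product of `D.α` off `D.S` is multipliable, and
  `StandardLFunctionData.L_eq_prod_mul_partialStandardL_iff` — at a given `s` the splitting holds
  iff that product is multipliable or the exceptional factor `∏_{v ∈ D.S} P_v(q_v^{-s})⁻¹` is `0`
  or `1`; in particular it holds at every `s` when `D.S = ∅`
  (`StandardLFunctionData.L_eq_prod_mul_partialStandardL_of_S_eq_empty`, empty product `= 1`);
* `StandardLFunctionData.multipliable_of_L_eq_partialStandardL_mul` — the local factors at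
  `v ∈ D.S` being free, the named fact for a `Π` ramified somewhere (`n ≥ 1`) *implies* the
  multipliability on `re s > 1` of the partial Euler product of every Satake family of `Π` off its
  ramified places, i.e. the statement of `multipliable_partialStandardL` (Thm. (5.3)) there: the
  fact is Thm. (5.3) in disguise and admits no proof by `tprod` bookkeeping alone;
* `StandardLFunctionData.L_eq_partialStandardL_mul_of_lt_re` — **unconditionally, the splitting
  holds on the half-plane `re s > n² + 2`** (where the partial Euler product converges absolutely
  by the trivial bound on Hecke–Satake parameters, `multipliable_partialStandardL_of_lt_re` of
  `SatakeParameterTrivialBound`; no named input);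
* `StandardLFunctionData.L_eq_partialStandardL_mul_of_local_quotients` — the named fact on
  `re s > 1` from the Rankin–Selberg quotient representation of `L_S(s, π × π̄)` (the hypothesis
  of `JacquetShalika1981_continuation_partialPairL_conj_of_local_quotients` of
  `RankinSelbergContinuationGlue`), i.e. from exactly what is left of the printed proof of
  Lemma (5.2) of the source; with `L_eq_partialStandardL_mul_of_continuation_partialPairL`
  (`AutomorphicLFunctionFlathProofs`: from Lemma (5.2) alone) this is the current frontier.

Dependency summary for the named fact: `L_eq_partialStandardL_mul ⇐ multipliable_partialStandardL`
(`AutomorphicLFunctionProofs`) `⇐ JacquetShalika1981_continuation_partialPairL_conj` (Lemma (5.2);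
`AutomorphicLFunctionFlathProofs`, Flath's theorem and the trivial bound being proved) `⇐` the
global Rankin–Selberg theory of §4 of the source (`RankinSelbergContinuationGlue`), not in the
tree. Proved unconditionally: rank `n ≤ 1` (`L_eq_partialStandardL_mul_of_le_one`,
`SatakeParameterUnitBound`), the half-plane `re s > n² + 2` (here), and data with `D.S = ∅`
(here; for such data the identity carries no convergence information).

## References

* H. Jacquet, J. A. Shalika, *On Euler products and the classification of automorphic
  representations I*, Amer. J. Math. 103 (1981), 499–558: §1; (5.1), Lemma (5.2) p. 554;
  Thm. (5.3) p. 555; Remark (5.4) p. 557 [JacquetShalikaAJM1981].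
* N. Bourbaki, *Topologie générale*, Ch. III §5 (summable families in commutative groups; the
  monoid-level bookkeeping here is the same).
-/

noncomputable section

open NumberField IsDedekindDomain MeasureTheory Polynomial Complex Filter Topology

namespace Literature.NumberTheory.Automorphic

/-! ### Splitting an unconditional product at a finite set -/

section Monoid

variable {ι M : Type*} [CommMonoid M] [TopologicalSpace M] {f : ι → M}

/-- **Splitting off a finite product** (monoid form of Mathlib's `Multipliable.prod_mul_tprod_compl`,
which is stated for topological groups): if `f` is multipliable off the finite set `s`, then
`(∏_{x ∈ s} f x) · ∏'_{x ∉ s} f x = ∏'_x f x` (`Finset.hasProd`, `HasProd.mul_compl`). [folklore] -/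
theorem prod_mul_tprod_compl_of_multipliable [ContinuousMul M] [T2Space M] (s : Finset ι)
    (h : Multipliable (f ∘ (↑) : ↥((↑s : Set ι)ᶜ) → M)) :
    (∏ x ∈ s, f x) * ∏' x : ↥((↑s : Set ι)ᶜ), f x = ∏' x, f x :=
  ((s.hasProd f).mul_compl h.hasProd).tprod_eq.symm

/-- **Multipliability off a finite set whose product is a unit.** In a commutative topological
monoid, if `f` is multipliable and `∏_{x ∈ s} f x` is a unit `u`, then `f` is multipliable off `s`:
the partial products over finite `t ⊆ sᶜ` are `u⁻¹ · ∏_{s ∪ t} f`, and `t ↦ s ∪ t` is cofinal.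
(For groups every element is a unit and this is Mathlib's `Finset.multipliable_compl_iff`; in `ℂ`
it fails without the unit hypothesis only through a vanishing factor on `s`.) [folklore] -/
theorem multipliable_compl_of_isUnit_prod [ContinuousMul M] (s : Finset ι) (hf : Multipliable f)
    (hu : IsUnit (∏ x ∈ s, f x)) : Multipliable (f ∘ (↑) : ↥((↑s : Set ι)ᶜ) → M) := by
  classical
  obtain ⟨a, ha⟩ := hf
  obtain ⟨u, hu⟩ := hu
  let e : ↥((↑s : Set ι)ᶜ) ↪ ι := Function.Embedding.subtype _
  -- `t ↦ s ∪ t` is cofinal among finite subsets of `ι`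
  have hg : Tendsto (fun t : Finset ↥((↑s : Set ι)ᶜ) => s ∪ t.map e) atTop atTop := by
    refine Filter.tendsto_atTop_atTop.mpr fun t₀ => ⟨t₀.subtype _, fun t ht x hx => ?_⟩
    by_cases hxs : x ∈ s
    · exact Finset.mem_union_left _ hxs
    · refine Finset.mem_union_right _ (Finset.mem_map.mpr ⟨⟨x, hxs⟩, ht ?_, rfl⟩)
      exact Finset.mem_subtype.mpr hx
  have hdisj : ∀ t : Finset ↥((↑s : Set ι)ᶜ), Disjoint s (t.map e) := by
    intro t
    refine Finset.disjoint_left.mpr fun x hxs hxt => ?_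
    obtain ⟨y, -, rfl⟩ := Finset.mem_map.mp hxt
    exact y.2 hxs
  -- partial products over `s ∪ t` are `u * (partial product over t)`
  have h1 : Tendsto (fun t : Finset ↥((↑s : Set ι)ᶜ) => (↑u : M) * ∏ x ∈ t, (f ∘ (↑)) x) atTop
      (𝓝 a) := by
    refine (ha.comp hg).congr fun t => ?_
    simp only [Function.comp_apply]
    rw [Finset.prod_union (hdisj t), Finset.prod_map, hu]
    rfl
  refine ⟨↑u⁻¹ * a, ?_⟩
  have h2 := h1.const_mul (↑u⁻¹ : M)
  simp only [Units.inv_mul_cancel_left] at h2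
  exact h2

end Monoid

section Field

variable {ι 𝕜 : Type*} [Field 𝕜] [TopologicalSpace 𝕜] [ContinuousMul 𝕜] [T2Space 𝕜]
  {f : ι → 𝕜}

/-- **When does an unconditional product split off a finite product?** In a Hausdorff topological
field (e.g. `ℂ`), for `f : ι → 𝕜` and a finite set `s`,
`∏'_x f x = (∏_{x ∈ s} f x) · ∏'_{x ∉ s} f x` holds **iff** `f` is multipliable off `s`, or
`∏_{x ∈ s} f x = 0`, or `∏_{x ∈ s} f x = 1`. Indeed: if the complementary product is multipliable
the identity is `prod_mul_tprod_compl_of_multipliable`; if some factor on `s` vanishes both sides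
are `0` (`tprod_of_exists_eq_zero`); otherwise `∏_{s} f` is a unit, so `f` itself is not
multipliable (`multipliable_compl_of_isUnit_prod`), the left side is the junk value `1` and the
right side is `∏_{s} f · 1`. [folklore] -/
theorem tprod_eq_prod_mul_tprod_compl_iff (s : Finset ι) :
    ∏' x, f x = (∏ x ∈ s, f x) * ∏' x : ↥((↑s : Set ι)ᶜ), f x ↔
      Multipliable (f ∘ (↑) : ↥((↑s : Set ι)ᶜ) → 𝕜) ∨ ∏ x ∈ s, f x = 0 ∨ ∏ x ∈ s, f x = 1 := by
  by_cases hc : Multipliable (f ∘ (↑) : ↥((↑s : Set ι)ᶜ) → 𝕜)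
  · simp only [hc, true_or, iff_true]
    exact (prod_mul_tprod_compl_of_multipliable s hc).symm
  by_cases h0 : ∏ x ∈ s, f x = 0
  · simp only [h0, true_or, or_true, iff_true, zero_mul]
    obtain ⟨x, -, hx⟩ := Finset.prod_eq_zero_iff.mp h0
    exact tprod_of_exists_eq_zero ⟨x, hx⟩
  have hf : ¬ Multipliable f := fun hf =>
    hc (multipliable_compl_of_isUnit_prod s hf (Ne.isUnit h0))
  have hc' : ¬ Multipliable fun x : ↥((↑s : Set ι)ᶜ) => f x := hc
  rw [tprod_eq_one_of_not_multipliable hf, tprod_eq_one_of_not_multipliable hc', mul_one]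
  simp only [hc, h0, false_or]
  exact eq_comm

/-- Outside the two degenerate cases (`∏_{s} f ∉ {0, 1}`) the splitting identity is *equivalent*
to the multipliability of `f` off `s`. [folklore] -/
theorem tprod_eq_prod_mul_tprod_compl_iff_multipliable (s : Finset ι) (h0 : ∏ x ∈ s, f x ≠ 0)
    (h1 : ∏ x ∈ s, f x ≠ 1) :
    ∏' x, f x = (∏ x ∈ s, f x) * ∏' x : ↥((↑s : Set ι)ᶜ), f x ↔
      Multipliable (f ∘ (↑) : ↥((↑s : Set ι)ᶜ) → 𝕜) := by
  rw [tprod_eq_prod_mul_tprod_compl_iff]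
  simp [h0, h1]

end Field

/-! ### The splitting of `D.L` -/

namespace StandardLFunctionData

variable {n : ℕ} {K : Type} [Field K] [NumberField K]
  {μ : Measure (AdelicGroupData.gl n K).automorphicQuotient}
  [(AdelicGroupData.gl n K).IsAutomorphicMeasure μ] {P : CuspidalAutomorphicRepGL n K μ}

/-- Off `D.S`, the inverted local factors of `D` are the inverted Satake Euler factors, as
functions on the complement subtype (`localFactor_of_not_mem`). [folklore] -/
theorem inv_eval_localFactor_comp_coe_compl (D : StandardLFunctionData P) (s : ℂ) :
    ((fun v : HeightOneSpectrum (𝓞 K) => ((D.localFactor v).eval ((v.residueCard : ℂ) ^ (-s)))⁻¹) ∘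
        ((↑) : ↥((↑D.S : Set (HeightOneSpectrum (𝓞 K)))ᶜ) → HeightOneSpectrum (𝓞 K))) =
      fun v : {v : HeightOneSpectrum (𝓞 K) // v ∉ (↑D.S : Set (HeightOneSpectrum (𝓞 K)))} =>
        ((eulerPolynomial (D.α v.1)).eval ((v.1.residueCard : ℂ) ^ (-s)))⁻¹ := by
  funext v
  have hv : (v : HeightOneSpectrum (𝓞 K)) ∉ D.S := by
    simpa only [Set.mem_compl_iff, Finset.mem_coe] using v.2
  simp only [Function.comp_apply, D.localFactor_of_not_mem _ hv]

/-- **Pointwise splitting.** If the partial Euler product `∏_{v ∉ D.S} (∏_{a ∈ α v}(1 - a q_v^{-s}))⁻¹`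
of the Satake family of `D` is multipliable at `s` (any `s`), then
`D.L s = (∏_{v ∈ D.S} P_v(q_v^{-s})⁻¹) · L^{D.S}(s, D.α)` (`prod_mul_tprod_compl_of_multipliable`
and `localFactor_of_not_mem`; Jacquet–Shalika (1981), (5.1), p. 554). The global named fact
`L_eq_partialStandardL_mul` is this at every `re s > 1`, where multipliability is Thm. (5.3) of
the source (`multipliable_partialStandardL`). [cite: JacquetShalikaAJM1981, (5.1) and Thm. (5.3)] -/
theorem L_eq_prod_mul_partialStandardL_of_multipliable (D : StandardLFunctionData P) {s : ℂ}
    (h : Multipliable fun v : {v : HeightOneSpectrum (𝓞 K) // v ∉ (↑D.S : Set (HeightOneSpectrum (𝓞 K)))} =>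
      ((eulerPolynomial (D.α v.1)).eval ((v.1.residueCard : ℂ) ^ (-s)))⁻¹) :
    D.L s = (∏ v ∈ D.S, ((D.localFactor v).eval ((v.residueCard : ℂ) ^ (-s)))⁻¹) *
      partialStandardL ↑D.S D.α s := by
  rw [← D.inv_eval_localFactor_comp_coe_compl s] at h
  rw [StandardLFunctionData.L, ← prod_mul_tprod_compl_of_multipliable D.S h]
  congr 1
  unfold partialStandardL
  exact tprod_congr fun v => by
    rw [D.localFactor_of_not_mem v.1 (by simpa only [Set.mem_compl_iff, Finset.mem_coe] using v.2)]

/-- **What the splitting at `s` amounts to.** For a datum `D` and any `s`, the identity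
`D.L s = (∏_{v ∈ D.S} P_v(q_v^{-s})⁻¹) · L^{D.S}(s, D.α)` holds iff the partial Euler product of
`D.α` off `D.S` is multipliable at `s`, or the exceptional factor `∏_{v ∈ D.S} P_v(q_v^{-s})⁻¹` is
`0`, or it is `1` (`tprod_eq_prod_mul_tprod_compl_iff`). Since the local factors of a datum at
`v ∈ D.S` are free polynomials with constant term `1`, the named fact `L_eq_partialStandardL_mul`
(all `D`, all `re s > 1`) therefore carries, for `Π` ramified somewhere and `n ≥ 1`, the content
of Jacquet–Shalika's Thm. (5.3) off the ramified places
(`multipliable_of_L_eq_partialStandardL_mul` below); it is not a `tprod` triviality. [folklore] -/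
theorem L_eq_prod_mul_partialStandardL_iff (D : StandardLFunctionData P) (s : ℂ) :
    D.L s = (∏ v ∈ D.S, ((D.localFactor v).eval ((v.residueCard : ℂ) ^ (-s)))⁻¹) *
      partialStandardL ↑D.S D.α s ↔
    (Multipliable fun v : {v : HeightOneSpectrum (𝓞 K) // v ∉ (↑D.S : Set (HeightOneSpectrum (𝓞 K)))} =>
        ((eulerPolynomial (D.α v.1)).eval ((v.1.residueCard : ℂ) ^ (-s)))⁻¹) ∨
      (∏ v ∈ D.S, ((D.localFactor v).eval ((v.residueCard : ℂ) ^ (-s)))⁻¹) = 0 ∨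
      (∏ v ∈ D.S, ((D.localFactor v).eval ((v.residueCard : ℂ) ^ (-s)))⁻¹) = 1 := by
  have hpart : partialStandardL ↑D.S D.α s =
      ∏' v : ↥((↑D.S : Set (HeightOneSpectrum (𝓞 K)))ᶜ),
        ((D.localFactor v).eval (((v : HeightOneSpectrum (𝓞 K)).residueCard : ℂ) ^ (-s)))⁻¹ := by
    unfold partialStandardL
    exact tprod_congr fun v => by
      rw [D.localFactor_of_not_mem v.1 (by simpa only [Set.mem_compl_iff, Finset.mem_coe] using v.2)]
  rw [hpart, ← D.inv_eval_localFactor_comp_coe_compl s, StandardLFunctionData.L]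
  exact tprod_eq_prod_mul_tprod_compl_iff D.S

/-- **Data with empty exceptional set.** If `D.S = ∅` the splitting
`D.L s = (∏_{v ∈ D.S} P_v(q_v^{-s})⁻¹) · L^{D.S}(s, D.α)` holds at *every* `s`, the exceptional factor
being the empty product `1` (third case of `L_eq_prod_mul_partialStandardL_iff`): both sides are
the same unconditional product up to reindexing, whatever its convergence (cf. `ofUnramified_L` of
`AutomorphicLFunction` for the canonical unramified datum). [folklore] -/
theorem L_eq_prod_mul_partialStandardL_of_S_eq_empty (D : StandardLFunctionData P) (hD : D.S = ∅)
    (s : ℂ) :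
    D.L s = (∏ v ∈ D.S, ((D.localFactor v).eval ((v.residueCard : ℂ) ^ (-s)))⁻¹) *
      partialStandardL ↑D.S D.α s :=
  (D.L_eq_prod_mul_partialStandardL_iff s).mpr (Or.inr (Or.inr (by rw [hD, Finset.prod_empty])))

/-- **The named fact carries Thm. (5.3) off the ramified places.** Let `Π` be cuspidal on
`GL_n(𝔸_K)` with `n ≥ 1`, `S` a *non-empty* finite set of ramified places of `Π` and `α` a Satake
family of `Π` off `S` (so `S` is exactly the set of ramified places). If
`L_eq_partialStandardL_mul` holds for `Π`, then the partial Euler product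
`∏_{v ∉ S} (∏_{a ∈ α v} (1 - a q_v^{-s}))⁻¹` is multipliable at every `re s > 1` — the statement of
`multipliable_partialStandardL` (Jacquet–Shalika (1981), Thm. (5.3)) for this `S`. Proof: apply the
fact to the datum with local factor `1 + q_{v₀}^{s} X` at one `v₀ ∈ S` and `1` at the other places
of `S`, whose exceptional factor at `s` is `(1 + q_{v₀}^{s} q_{v₀}^{-s})⁻¹ = 1/2 ∉ {0, 1}`, and use
`L_eq_prod_mul_partialStandardL_iff`. (For `S = ∅` the fact is the unconditional identity
`L_eq_prod_mul_partialStandardL_of_S_eq_empty` and carries no convergence information.)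
[folklore] -/
theorem multipliable_of_L_eq_partialStandardL_mul (hn : 1 ≤ n)
    (h : L_eq_partialStandardL_mul (P := P)) {S : Finset (HeightOneSpectrum (𝓞 K))}
    (hS : ∀ v ∈ S, ¬ IsUnramifiedAt P.1 v) (hne : S.Nonempty) {α : SatakeFamily K}
    (hα : IsSatakeFamilyOf P ↑S α) {s : ℂ} (hs : 1 < s.re) :
    Multipliable fun v : {v : HeightOneSpectrum (𝓞 K) // v ∉ (↑S : Set (HeightOneSpectrum (𝓞 K)))} =>
      ((eulerPolynomial (α v.1)).eval ((v.1.residueCard : ℂ) ^ (-s)))⁻¹ := by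
  classical
  obtain ⟨v₀, hv₀⟩ := hne
  set q : ℂ := (v₀.residueCard : ℂ) with hq
  have hq0 : q ≠ 0 := by
    rw [hq, Nat.cast_ne_zero]
    have := v₀.one_lt_residueCard
    omega
  -- the datum with local factor `1 + q^{s} X` at `v₀` and `1` at the other exceptional places
  let D : StandardLFunctionData P :=
    { S := S
      α := α
      isSatakeFamily := hα
      not_isUnramifiedAt := hS
      localFactor := fun v =>
        if v ∈ S then (if v = v₀ then 1 + C (q ^ s) * X else 1) else eulerPolynomial (α v)
      localFactor_of_not_mem := fun v hv => if_neg hv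
      eval_zero_localFactor := fun v => by split_ifs <;> simp
      natDegree_localFactor_le := fun v => by
        split_ifs with hv hv0
        · calc (1 + C (q ^ s) * X : ℂ[X]).natDegree
              ≤ max (1 : ℂ[X]).natDegree (C (q ^ s) * X : ℂ[X]).natDegree := natDegree_add_le _ _
            _ ≤ 1 := by
                rw [natDegree_one]
                exact max_le zero_le_one ((natDegree_C_mul_le _ _).trans natDegree_X_le)
            _ ≤ n := hn
        · simp
        · exact (natDegree_eulerPolynomial_le (α v)).trans (hα.card_eq (by simpa using hv)).le }
  -- its exceptional factor at `s` is `1/2`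
  have hF : (∏ v ∈ D.S, ((D.localFactor v).eval ((v.residueCard : ℂ) ^ (-s)))⁻¹) = 2⁻¹ := by
    have h1 : q ^ s * q ^ (-s) = 1 := by
      rw [← Complex.cpow_add _ _ hq0, add_neg_cancel, Complex.cpow_zero]
    show (∏ v ∈ S, ((eval ((v.residueCard : ℂ) ^ (-s))
      (if v ∈ S then (if v = v₀ then 1 + C (q ^ s) * X else 1) else eulerPolynomial (α v)))⁻¹)) = 2⁻¹
    rw [Finset.prod_eq_single_of_mem v₀ hv₀ fun v hv hne => by simp [hv, hne]]
    simp only [hv₀, if_true, eval_add, eval_one, eval_mul, eval_C, eval_X, ← hq, h1]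
    norm_num
  rcases (D.L_eq_prod_mul_partialStandardL_iff s).mp (h D hs) with hm | h0 | h1
  · exact hm
  · rw [hF] at h0; norm_num at h0
  · rw [hF] at h1; norm_num at h1

/-- **The splitting holds unconditionally on `re s > n² + 2`.** For every standard `L`-function
datum `D` of a cuspidal `Π` on `GL_n(𝔸_K)` and `re s > n² + 2`,
`D.L s = (∏_{v ∈ D.S} P_v(q_v^{-s})⁻¹) · L^{D.S}(s, D.α)`, with no named input: there the partial
Euler product converges absolutely by the trivial bound `|a| ≤ q_v^{n² + 1}` on the Hecke–Satake
parameters (`multipliable_partialStandardL_of_lt_re` of `SatakeParameterTrivialBound`; the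
analogue of "(5.1.4) converges absolutely in some right half-plane", Jacquet–Shalika (1981),
p. 554). The named fact `L_eq_partialStandardL_mul` is the same identity on `re s > 1`.
[cite: JacquetShalikaAJM1981, (5.1), (5.1.4)] -/
theorem L_eq_partialStandardL_mul_of_lt_re (D : StandardLFunctionData P) {s : ℂ}
    (hs : (n : ℝ) ^ 2 + 2 < s.re) :
    D.L s = (∏ v ∈ D.S, ((D.localFactor v).eval ((v.residueCard : ℂ) ^ (-s)))⁻¹) *
      partialStandardL ↑D.S D.α s :=
  D.L_eq_prod_mul_partialStandardL_of_multipliable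
    (multipliable_partialStandardL_of_lt_re D.isSatakeFamily hs)

/-- **The named fact `L_eq_partialStandardL_mul` from the Rankin–Selberg quotient representation of
`L_S(s, π × π̄)`** — the hypothesis of
`JacquetShalika1981_continuation_partialPairL_conj_of_local_quotients` of
`RankinSelbergContinuationGlue` (for every cuspidal `Π`, a finite `S₀` such that for all finite
`S ⊇ S₀`, every Satake family `α` of `Π` off `S`, and every `s₀` with `re s₀ > 1`, functions
`I`, `A` holomorphic on `re s > 1` with `A(s₀) ≠ 0` and `I = A · L_S(·, α × ᾱ)` far to the right:
in the source `I = Ψ(s, W', W, Φ)`, `A = ∏_{v ∈ S} Ψ_v`, §4 and p. 555) — via Lemma (5.2)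
(`JacquetShalika1981_continuation_partialPairL_conj_of_local_quotients`) and
`L_eq_partialStandardL_mul_of_continuation_partialPairL` (`AutomorphicLFunctionFlathProofs`).
This is what remains to be supplied for an unconditional `L_eq_partialStandardL_mul_holds`.
[cite: JacquetShalikaAJM1981, Lemma (5.2), Thm. (5.3)] -/
theorem L_eq_partialStandardL_mul_of_local_quotients
    (h : ∀ P : CuspidalAutomorphicRepGL n K μ, ∃ S₀ : Finset (HeightOneSpectrum (𝓞 K)),
      ∀ ⦃S : Finset (HeightOneSpectrum (𝓞 K))⦄ ⦃α : SatakeFamily K⦄, S₀ ⊆ S →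
        IsSatakeFamilyOf P ↑S α → ∃ x₀ : ℝ, ∀ s₀ : ℂ, 1 < s₀.re →
          ∃ I A : ℂ → ℂ, DifferentiableOn ℂ I {s : ℂ | 1 < s.re} ∧
            DifferentiableOn ℂ A {s : ℂ | 1 < s.re} ∧ A s₀ ≠ 0 ∧
              ∀ s : ℂ, 1 < s.re → x₀ < s.re →
                I s = A s * partialPairL ↑S α (conjFamily α) s) :
    L_eq_partialStandardL_mul (P := P) :=
  L_eq_partialStandardL_mul_of_continuation_partialPairL
    (JacquetShalika1981_continuation_partialPairL_conj_of_local_quotients h)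

end StandardLFunctionData

end Literature.NumberTheory.Automorphic
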